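import Mathlib
import HarnessLib.Audit
import Summits.PneNP.PneNP.Theorems.PstarGateCaseTSixPin
import Summits.PneNP.PneNP.Theorems.PstarGateCaseTPrivateTouch
import Summits.PneNP.PneNP.Theorems.PstarGateCaseTQuadCube

/-!
# One GATED chord, CASE T with `q_mv` NOT affine: two other chords and two globally private cycle edges are impossible (E2 node N4X; prover-1 g20)

FRONTIER range-avoidance ladder, rung F-N3 (`stmt-PneNP-19007`), cell `pnp-ideate` (`PstarGateNodesX.GateCaseTQuadX`); restricted-model proof
complexity — nothing here bears on `P` versus `NP`.

The residual of the N4X count: CASE T, two other chords `c₁ ≠ c₂` (with `u`-edges `m_i = (u, v_i)`, `v₁ ≠ v₂`, `u_{c_i} = u_e + 1 + x_u x_{v_i}`,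
`PstarGateCaseTSixPin.u_other_eq`), and the `u`-avoiding edges of `D e` are exactly two GLOBALLY private edges `π = (α, α')`, `ν = (β, β')`.  So on
`H₁ = {x_u = κ₀+1}`: `u_e = γ + x_α x_{α'} + x_β x_{β'}`; on `H₀`: the same plus a linear function in other coordinates.  (T3) gives
(b) `q = 1 ⟹ u_e = 0` on `H₁` (`caseT_q_zero_of_on`) and (c) `q = 0 ⟹ u_{c₁} = u_{c₂} = 1` on `H₀` (`caseT_forced` at `ℓ = 0`), i.e. `q = 0 ⟹
x_{v₁} = x_{v₂} ∧ u_e = x_{v₁}` there; so `q ≡ 1` on `H₀ ∖ K`, `K = {x_{v₁} = x_{v₂}}`.  On the 16-point cubes `y ⊕ s` spanned by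
`e_α, e_{α'}, e_β, e_{β'}` the form `u_e` is `γ' + (y_α+s₁)(y_{α'}+s₂) + (y_β+s₃)(y_{β'}+s₄)`, whose level sets contain no zero set of a
non-vanishing affine function of `s` (`PstarGateCaseTQuadCube.cube16`).  Applied to the affine `d = q + q(· + e_u)` on `H₁ ∖ K` (where `q = 1 + d`):
`q ≡ 0` on `H₁ ∖ K`, hence `polarDir mv` vanishes on the four private directions; applied then to `q` itself on `H₀ ∩ K`: `q ≡ 1` on `H₀`.  Finally
`d` is constant `1 + ε` on `H₁ ∩ K`: `ε = 0` makes `q = x_u + κ₀ + 1` affine, `ε = 1` makes `q ≡ 1` on `H₁ ∩ K`, so `u_e ≡ 0` there by (b) —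
but `u_e(0) ≠ u_e(e_α + e_{α'})`:

* `caseT_quad_three_false` — **contradiction.**
-/

set_option linter.dupNamespace false -- `Summit.PneNP.PneNP.…`: summit = sub-problem name (D-0017 single-conjunct layout)

open Finset Module Literature.Computability.Complexity
open scoped symmDiff
open Summit.PneNP.PneNP.Theorems.PstarTyped (Typed)
open Summit.PneNP.PneNP.Theorems.PstarSALevel (varSet bdry BoundaryExpanding SimpleOverlap)
open Summit.PneNP.PneNP.Theorems.PstarGapLinearised (andPair andPair_subset_varSet)
open Summit.PneNP.PneNP.Theorems.PstarChordEndgameTools (mem_andPair_iff)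
open Summit.PneNP.PneNP.Theorems.PstarCentreFree (vars_mem_varSet)
open Summit.PneNP.PneNP.Theorems.PstarCubeIdeals (IsAffineFn)
open Summit.PneNP.PneNP.Theorems.PstarPathRank (andPair_ne)
open Summit.PneNP.PneNP.Theorems.PstarReadSumset (V2)
open Summit.PneNP.PneNP.Theorems.PstarChordSystem (ChordSystem)
open Summit.PneNP.PneNP.Theorems.PstarChordBridgeTools (privs coef xpdeg)
open Summit.PneNP.PneNP.Theorems.PstarChordBridge (BridgeData sys Solution Lift)
open Summit.PneNP.PneNP.Theorems.PstarChordBridgeForcing (gam sys_u_eq)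
open Summit.PneNP.PneNP.Theorems.PstarChordBridgeBasis (qDir polarDir)
open Summit.PneNP.PneNP.Theorems.PstarChordBridgeCorner (qDir_add)
open Summit.PneNP.PneNP.Theorems.PstarChordBridgeFundamental (eq_of_fundamental_eq)
open Summit.PneNP.PneNP.Theorems.PstarGateBridge (GateHyp)
open Summit.PneNP.PneNP.Theorems.PstarGateCaseT (caseT_forced)
open Summit.PneNP.PneNP.Theorems.PstarGateNodes (GateData)
open Summit.PneNP.PneNP.Theorems.PstarGateNodesX (GateDataX)
open Summit.PneNP.PneNP.Theorems.PstarGateCaseTStructure (caseT_through caseT_diff_single)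
open Summit.PneNP.PneNP.Theorems.PstarGateCaseTPrivateCycleQuad (caseT_q_zero_of_on)
open Summit.PneNP.PneNP.Theorems.PstarGateCaseTPrivateTouch (u_flip_fst u_flip_snd)
open Summit.PneNP.PneNP.Theorems.PstarGateCaseTSixPin (u_other_eq)
open Summit.PneNP.PneNP.Theorems.PstarGateCaseTQuadCube (cube16)

namespace Summit.PneNP.PneNP.Theorems.PstarGateCaseTQuadThree

variable {n m : ℕ}

/-! ## Instance level -/

/-- **The residual of N4X with two other chords is empty.**  See the module docstring. -/
theorem caseT_quad_three_false (I : LocalMap 4 n m) (hI : I.IsPure xorAndPred) (hT : Typed I) (hS : SimpleOverlap I) {r₀ : ℕ}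
    (hB : BoundaryExpanding r₀ I) {B : BridgeData n m} {e g₀ : Fin m} {u : Fin n} {κ₀ : ZMod 2} (hD : GateDataX I r₀ B e g₀ u κ₀)
    {mv : V2} (hmvT : mv = (0, 1) ∨ mv = (1, 1))
    (hP : ∀ e' ∈ B.N, e' ≠ e → ∀ a, ((sys I B).ρ e' a = 0 ∨ (sys I B).ρ e' a = mv) ∧ ((sys I B).ρ' e' a = 0 ∨ (sys I B).ρ' e' a = mv))
    (hread : ∀ e' ∈ B.N, e' ≠ e → ∀ a, (sys I B).ρ e' a ≠ 0 ∨ (sys I B).ρ' e' a ≠ 0)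
    (hq : ¬ IsAffineFn (qDir I B mv)) {c₁ c₂ : Fin m} (hc₁ : c₁ ∈ B.N.erase e) (hc₂ : c₂ ∈ B.N.erase e) (hc12 : c₁ ≠ c₂)
    {π ν : Fin m} (hπD : π ∈ B.D e) (hνD : ν ∈ B.D e) (hπν : π ≠ ν)
    (hprivπ : ∀ j' ∈ insert g₀ B.J₀, j' ≠ π → I.vars π 2 ∉ varSet I j' ∧ I.vars π 3 ∉ varSet I j')
    (hprivν : ∀ j' ∈ insert g₀ B.J₀, j' ≠ ν → I.vars ν 2 ∉ varSet I j' ∧ I.vars ν 3 ∉ varSet I j')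
    (honly : ∀ j ∈ B.D e, I.vars j 2 ≠ u → I.vars j 3 ≠ u → j = π ∨ j = ν) : False := by
  classical
  obtain ⟨hXc, hW, hr, hd₁, hd₂, hL, -, -, hG, hg₀, hgv, -, hup, hux, hG₁p, hcoef, hT3, hM0⟩ := id hD
  have he : e ∈ B.N := hG.1
  have hg₀J : g₀ ∉ B.J₀ := fun h => disjoint_left.1 hd₁ hg₀ h
  have hDeJ : B.D e ⊆ B.J₀ := fun j hj => (mem_sdiff.1 (hW.hD e he hj)).1
  have hN : (B.N.erase e).Nonempty := ⟨c₁, hc₁⟩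
  obtain ⟨hc₁e, hc₁N⟩ := mem_erase.1 hc₁
  obtain ⟨hc₂e, hc₂N⟩ := mem_erase.1 hc₂
  have hκ := (caseT_through I hI hT hS hB hD hmvT hP hread hc₁N hc₁e).2
  -- privacy consequences: `π, ν` avoid `u` (held by `g₀`), and their variables avoid every other output of `J₀`
  have hu_g₀ : u ∈ varSet I g₀ := by rcases hgv with ⟨-, h⟩ | ⟨h, -⟩ <;> exact h ▸ vars_mem_varSet I g₀ _
  have hπ2 : I.vars π 2 ≠ u := fun h => (hprivπ g₀ (mem_insert_self _ _) (fun h' => hg₀J (h' ▸ hDeJ hπD))).1 (h ▸ hu_g₀)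
  have hπ3 : I.vars π 3 ≠ u := fun h => (hprivπ g₀ (mem_insert_self _ _) (fun h' => hg₀J (h' ▸ hDeJ hπD))).2 (h ▸ hu_g₀)
  have hν2 : I.vars ν 2 ≠ u := fun h => (hprivν g₀ (mem_insert_self _ _) (fun h' => hg₀J (h' ▸ hDeJ hνD))).1 (h ▸ hu_g₀)
  have hν3 : I.vars ν 3 ≠ u := fun h => (hprivν g₀ (mem_insert_self _ _) (fun h' => hg₀J (h' ▸ hDeJ hνD))).2 (h ▸ hu_g₀)
  -- the `u`-edges `mᵢ = (u, vᵢ)` of the two other chords, `v₁ ≠ v₂`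
  have hv₀ex : ∀ {c : Fin m}, c ∈ B.N → c ≠ e → ∃ m₀ v₀, B.D e ∆ B.D c = {m₀} ∧ v₀ ≠ u ∧ m₀ ∈ B.J₀ ∧ v₀ ∈ varSet I m₀ ∧
      ((I.vars m₀ 2 = u ∧ I.vars m₀ 3 = v₀) ∨ (I.vars m₀ 2 = v₀ ∧ I.vars m₀ 3 = u)) := by
    intro c hc hce
    obtain ⟨m₀, hm₀, hm₀u, -⟩ := caseT_diff_single I hI hT hS hB hD hmvT hP hread hc hce
    have hm₀J : m₀ ∈ B.J₀ := by
      have h : m₀ ∈ B.D e ∆ B.D c := by rw [hm₀]; exact mem_singleton_self _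
      rcases Finset.mem_symmDiff.1 h with ⟨h, -⟩ | ⟨h, -⟩
      · exact hDeJ h
      · exact (mem_sdiff.1 (hW.hD c hc h)).1
    have h23 : I.vars m₀ 2 ≠ I.vars m₀ 3 := fun h => absurd (hI.2 m₀ h) (by decide)
    rcases hm₀u with h2 | h3
    · exact ⟨m₀, I.vars m₀ 3, hm₀, fun h => h23 (h2.trans h.symm), hm₀J, vars_mem_varSet I m₀ 3, Or.inl ⟨h2, rfl⟩⟩
    · exact ⟨m₀, I.vars m₀ 2, hm₀, fun h => h23 (h.trans h3.symm), hm₀J, vars_mem_varSet I m₀ 2, Or.inr ⟨rfl, h3⟩⟩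
  obtain ⟨m₁, v₁, hm₁, hv₁u, hm₁J, hv₁m, hv₁⟩ := hv₀ex hc₁N hc₁e
  obtain ⟨m₂, v₂, hm₂, hv₂u, hm₂J, hv₂m, hv₂⟩ := hv₀ex hc₂N hc₂e
  have hsub₁ := u_other_eq I hI hT hS hB hD hmvT hP hread hc₁N hc₁e hm₁ hv₁
  have hsub₂ := u_other_eq I hI hT hS hB hD hmvT hP hread hc₂N hc₂e hm₂ hv₂
  have hv12 : v₁ ≠ v₂ := by
    intro hvv
    subst hvv
    have hmm : m₁ = m₂ := by
      by_contra hne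
      refine andPair_ne I hI hS hne ?_
      rcases hv₁ with ⟨h2, h3⟩ | ⟨h2, h3⟩ <;> rcases hv₂ with ⟨h2', h3'⟩ | ⟨h2', h3'⟩
      · exact Or.inl ⟨h2.trans h2'.symm, h3.trans h3'.symm⟩
      · exact Or.inr ⟨h2.trans h3'.symm, h3.trans h2'.symm⟩
      · exact Or.inr ⟨h2.trans h3'.symm, h3.trans h2'.symm⟩
      · exact Or.inl ⟨h2.trans h2'.symm, h3.trans h3'.symm⟩
    subst hmm
    have hDD : B.D c₁ = B.D c₂ := by
      have h1 : B.D c₁ = B.D e ∆ {m₁} := by rw [← hm₁, ← symmDiff_assoc, symmDiff_self, bot_symmDiff]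
      have h2 : B.D c₂ = B.D e ∆ {m₁} := by rw [← hm₂, ← symmDiff_assoc, symmDiff_self, bot_symmDiff]
      rw [h1, h2]
    have h1D : c₁ ∉ B.D c₁ := fun h => (mem_sdiff.1 (hW.hD c₁ hc₁N h)).2 hc₁N
    have hcD : c₂ ∉ B.D c₁ := fun h => (mem_sdiff.1 (hW.hD c₁ hc₁N h)).2 hc₂N
    have hev' : ∀ w, Even (xpdeg I (insert c₂ (B.D c₁)) w) := fun w => by rw [hDD]; exact hW.hDeven c₂ hc₂N w
    exact hc12 (eq_of_fundamental_eq I hI hS h1D hcD (hW.hDeven c₁ hc₁N) hev')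
  -- the four private coordinates
  set a : Fin 4 → Fin n := ![I.vars π 2, I.vars π 3, I.vars ν 2, I.vars ν 3] with ha
  have ha0 : a 0 = I.vars π 2 := rfl
  have ha1 : a 1 = I.vars π 3 := rfl
  have ha2 : a 2 = I.vars ν 2 := rfl
  have ha3 : a 3 = I.vars ν 3 := rfl
  have hνJ : ν ∈ B.J₀ := hDeJ hνD
  have hπJ : π ∈ B.J₀ := hDeJ hπD
  have hπν' := hprivπ ν (mem_insert_of_mem hνJ) (Ne.symm hπν)
  have h01 : a 0 ≠ a 1 := fun h => absurd (hI.2 π h) (by decide)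
  have h23 : a 2 ≠ a 3 := fun h => absurd (hI.2 ν h) (by decide)
  have h02 : a 0 ≠ a 2 := fun h => hπν'.1 (by rw [ha0] at h; rw [h]; exact vars_mem_varSet I ν 2)
  have h03 : a 0 ≠ a 3 := fun h => hπν'.1 (by rw [ha0] at h; rw [h]; exact vars_mem_varSet I ν 3)
  have h12 : a 1 ≠ a 2 := fun h => hπν'.2 (by rw [ha1] at h; rw [h]; exact vars_mem_varSet I ν 2)
  have h13 : a 1 ≠ a 3 := fun h => hπν'.2 (by rw [ha1] at h; rw [h]; exact vars_mem_varSet I ν 3)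
  -- the coordinates `u, v₁, v₂` are none of the four
  have hm₁π : m₁ ≠ π := by
    rintro rfl; rcases hv₁ with ⟨h, -⟩ | ⟨-, h⟩; exacts [hπ2 h, hπ3 h]
  have hm₁ν : m₁ ≠ ν := by
    rintro rfl; rcases hv₁ with ⟨h, -⟩ | ⟨-, h⟩; exacts [hν2 h, hν3 h]
  have hm₂π : m₂ ≠ π := by
    rintro rfl; rcases hv₂ with ⟨h, -⟩ | ⟨-, h⟩; exacts [hπ2 h, hπ3 h]
  have hm₂ν : m₂ ≠ ν := by
    rintro rfl; rcases hv₂ with ⟨h, -⟩ | ⟨-, h⟩; exacts [hν2 h, hν3 h]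
  have p₁ := hprivπ m₁ (mem_insert_of_mem hm₁J) hm₁π
  have p₂ := hprivπ m₂ (mem_insert_of_mem hm₂J) hm₂π
  have n₁ := hprivν m₁ (mem_insert_of_mem hm₁J) hm₁ν
  have n₂ := hprivν m₂ (mem_insert_of_mem hm₂J) hm₂ν
  have hau : ∀ i, a i ≠ u := by
    intro i
    match i with
    | ⟨0, _⟩ => exact hπ2
    | ⟨1, _⟩ => exact hπ3
    | ⟨2, _⟩ => exact hν2
    | ⟨3, _⟩ => exact hν3
  have hav : ∀ i, a i ≠ v₁ ∧ a i ≠ v₂ := by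
    intro i
    match i with
    | ⟨0, _⟩ => exact ⟨fun h => p₁.1 (by rw [show I.vars π 2 = v₁ from h]; exact hv₁m), fun h => p₂.1 (by rw [show I.vars π 2 = v₂ from h]; exact hv₂m)⟩
    | ⟨1, _⟩ => exact ⟨fun h => p₁.2 (by rw [show I.vars π 3 = v₁ from h]; exact hv₁m), fun h => p₂.2 (by rw [show I.vars π 3 = v₂ from h]; exact hv₂m)⟩
    | ⟨2, _⟩ => exact ⟨fun h => n₁.1 (by rw [show I.vars ν 2 = v₁ from h]; exact hv₁m), fun h => n₂.1 (by rw [show I.vars ν 2 = v₂ from h]; exact hv₂m)⟩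
    | ⟨3, _⟩ => exact ⟨fun h => n₁.2 (by rw [show I.vars ν 3 = v₁ from h]; exact hv₁m), fun h => n₂.2 (by rw [show I.vars ν 3 = v₂ from h]; exact hv₂m)⟩
  -- flip rules for `u_e` along the four coordinates
  have hA0 : ∀ z, (sys I B).u e (z + Pi.single (a 0) 1) = (sys I B).u e z + z (a 1) := fun z =>
    u_flip_fst I hI hT hS hB hD hmvT hP hread hπD hπ2 hπ3 hprivπ he z
  have hA1 : ∀ z, (sys I B).u e (z + Pi.single (a 1) 1) = (sys I B).u e z + z (a 0) := fun z =>
    u_flip_snd I hI hT hS hB hD hmvT hP hread hπD hπ2 hπ3 hprivπ he z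
  have hA2 : ∀ z, (sys I B).u e (z + Pi.single (a 2) 1) = (sys I B).u e z + z (a 3) := fun z =>
    u_flip_fst I hI hT hS hB hD hmvT hP hread hνD hν2 hν3 hprivν he z
  have hA3 : ∀ z, (sys I B).u e (z + Pi.single (a 3) 1) = (sys I B).u e z + z (a 2) := fun z =>
    u_flip_snd I hI hT hS hB hD hmvT hP hread hνD hν2 hν3 hprivν he z
  -- coordinates under the four flips
  have hcu : ∀ i (z : Fin n → ZMod 2), ((z + Pi.single (a i) (1 : ZMod 2) : Fin n → ZMod 2) u) = z u := fun i z => by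
    rw [Pi.add_apply, Pi.single_eq_of_ne (Ne.symm (hau i)), add_zero]
  have hcv₁ : ∀ i (z : Fin n → ZMod 2), ((z + Pi.single (a i) (1 : ZMod 2) : Fin n → ZMod 2) v₁) = z v₁ := fun i z => by
    rw [Pi.add_apply, Pi.single_eq_of_ne (Ne.symm (hav i).1), add_zero]
  have hcv₂ : ∀ i (z : Fin n → ZMod 2), ((z + Pi.single (a i) (1 : ZMod 2) : Fin n → ZMod 2) v₂) = z v₂ := fun i z => by
    rw [Pi.add_apply, Pi.single_eq_of_ne (Ne.symm (hav i).2), add_zero]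
  -- scaled versions of the coordinate facts, for the cube points
  have z01 : ∀ t : ZMod 2, t = 0 ∨ t = 1 := by decide
  have hcuS : ∀ i (s : ZMod 2) (z : Fin n → ZMod 2), ((z + s • Pi.single (a i) (1 : ZMod 2) : Fin n → ZMod 2) u) = z u := by
    intro i s z; rcases z01 s with rfl | rfl
    · rw [zero_smul, add_zero]
    · rw [one_smul, hcu]
  have hcv₁S : ∀ i (s : ZMod 2) (z : Fin n → ZMod 2), ((z + s • Pi.single (a i) (1 : ZMod 2) : Fin n → ZMod 2) v₁) = z v₁ := by
    intro i s z; rcases z01 s with rfl | rfl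
    · rw [zero_smul, add_zero]
    · rw [one_smul, hcv₁]
  have hcv₂S : ∀ i (s : ZMod 2) (z : Fin n → ZMod 2), ((z + s • Pi.single (a i) (1 : ZMod 2) : Fin n → ZMod 2) v₂) = z v₂ := by
    intro i s z; rcases z01 s with rfl | rfl
    · rw [zero_smul, add_zero]
    · rw [one_smul, hcv₂]
  have cube_u : ∀ (y : Fin n → ZMod 2) (s₁ s₂ s₃ s₄ : ZMod 2),
      ((y + s₁ • Pi.single (a 0) (1 : ZMod 2) + s₂ • Pi.single (a 1) (1 : ZMod 2) + s₃ • Pi.single (a 2) (1 : ZMod 2) +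
        s₄ • Pi.single (a 3) (1 : ZMod 2) : Fin n → ZMod 2) u) = y u := by
    intro y s₁ s₂ s₃ s₄; rw [hcuS, hcuS, hcuS, hcuS]
  have cube_v₁ : ∀ (y : Fin n → ZMod 2) (s₁ s₂ s₃ s₄ : ZMod 2),
      ((y + s₁ • Pi.single (a 0) (1 : ZMod 2) + s₂ • Pi.single (a 1) (1 : ZMod 2) + s₃ • Pi.single (a 2) (1 : ZMod 2) +
        s₄ • Pi.single (a 3) (1 : ZMod 2) : Fin n → ZMod 2) v₁) = y v₁ := by
    intro y s₁ s₂ s₃ s₄; rw [hcv₁S, hcv₁S, hcv₁S, hcv₁S]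
  have cube_v₂ : ∀ (y : Fin n → ZMod 2) (s₁ s₂ s₃ s₄ : ZMod 2),
      ((y + s₁ • Pi.single (a 0) (1 : ZMod 2) + s₂ • Pi.single (a 1) (1 : ZMod 2) + s₃ • Pi.single (a 2) (1 : ZMod 2) +
        s₄ • Pi.single (a 3) (1 : ZMod 2) : Fin n → ZMod 2) v₂) = y v₂ := by
    intro y s₁ s₂ s₃ s₄; rw [hcv₂S, hcv₂S, hcv₂S, hcv₂S]
  -- (b) on `H₁` and (c) on `H₀`
  set q := qDir I B mv with hqdef
  have hb : ∀ y : Fin n → ZMod 2, y u = κ₀ + 1 → q y = 1 → (sys I B).u e y = 0 := by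
    intro y hyu hqy
    by_contra hne
    have h1 : (sys I B).u e y = 1 := (z01 _).resolve_left hne
    have h := caseT_q_zero_of_on I hI hT hS hB hD hmvT hP hread hN hyu h1
    rw [← hqdef, hqy] at h
    exact one_ne_zero h
  have hc : ∀ x : Fin n → ZMod 2, x u = κ₀ → q x = 0 → x v₁ = x v₂ ∧ (sys I B).u e x = x v₁ := by
    intro x hxu hqx
    have hc0 : coef I B.C₁ B.G₁ (I.vars e 2) x = 0 := by rw [hcoef, hxu]; exact CharTwo.add_self_eq_zero κ₀
    have hx : ((sys I B).u e x = 0 ∧ coef I B.C₁ B.G₁ (I.vars e 2) x = 1) ∨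
        qDir I B mv x + (sys I B).u e x * coef I B.C₁ B.G₁ (I.vars e 2) x = 0 := by
      right; rw [hc0, mul_zero, add_zero]; exact hqx
    have hon := caseT_forced I hI hT hW hL hG hT3 hmvT hP hread hx
    have h1 := hsub₁ x
    have h2 := hsub₂ x
    rw [sys_u_eq I B c₁, hon c₁ hc₁N hc₁e, hxu, hκ, one_mul] at h1
    rw [sys_u_eq I B c₂, hon c₂ hc₂N hc₂e, hxu, hκ, one_mul] at h2
    have e3 : ∀ g U t : ZMod 2, g + (g + 1) = U + 1 + t → U = t := by decide
    exact ⟨(e3 _ _ _ h1).symm.trans (e3 _ _ _ h2), e3 _ _ _ h1⟩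
  -- `q ≡ 1` on `H₀ ∖ K`
  have hq0K : ∀ x : Fin n → ZMod 2, x u = κ₀ → x v₁ ≠ x v₂ → q x = 1 := by
    intro x hxu hne
    by_contra h
    exact hne (hc x hxu ((z01 _).resolve_right h)).1
  -- the affine difference across the chambers
  set eu : Fin n → ZMod 2 := Pi.single u 1 with heu
  set d : (Fin n → ZMod 2) → ZMod 2 := fun y => q y + q (y + eu) with hddef
  have hd_flip : ∀ (v y : Fin n → ZMod 2), d (y + v) = d y + polarDir I B mv v eu := by
    intro v y
    simp only [hddef, hqdef]
    have h3 : y + v + eu = (y + eu) + v := by abel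
    rw [h3, qDir_add I B mv y v, qDir_add I B mv (y + eu) v, map_add, LinearMap.add_apply, PstarChordBridgeNor.polarDir_comm I B mv eu v]
    generalize qDir I B mv y = q1; generalize qDir I B mv v = q2; generalize qDir I B mv 0 = q3; generalize qDir I B mv (y + eu) = q4
    generalize polarDir I B mv y v = p1; generalize polarDir I B mv v eu = p2
    revert q1 q2 q3 q4 p1 p2; decide
  -- STEP 1: on `H₁ ∖ K`, `q ≡ 0` (the cube argument for the affine `d`)
  have hH1K : ∀ y : Fin n → ZMod 2, y u = κ₀ + 1 → y v₁ ≠ y v₂ → q y = 0 := by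
    intro y hyu hyv
    -- on the cube of `y`: `q = 1 + d`
    have hqd : ∀ z : Fin n → ZMod 2, z u = κ₀ + 1 → z v₁ ≠ z v₂ → q z = 1 + d z := by
      intro z hzu hzv
      have hz' : (z + eu) u = κ₀ := by rw [Pi.add_apply, hzu, heu, Pi.single_eq_same, hκ]; decide
      have hzv' : (z + eu) v₁ ≠ (z + eu) v₂ := by
        rwa [Pi.add_apply, Pi.add_apply, heu, Pi.single_eq_of_ne hv₁u, Pi.single_eq_of_ne hv₂u, add_zero, add_zero]
      simp only [hddef]
      rw [hq0K _ hz' hzv']; generalize q z = t; revert t; decide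
    have hres := cube16 (Q := d) (A := (sys I B).u e) (L := fun i _ => polarDir I B mv (Pi.single (a i) 1) eu) (a := a)
      (fun i z => hd_flip _ z) (fun _ _ _ => rfl) hA0 hA1 hA2 hA3 h02 h03 h12 h13 y 0 (fun s₁ s₂ s₃ s₄ hs => by
        have hzu := cube_u y s₁ s₂ s₃ s₄
        rw [hyu] at hzu
        have hzv : ((y + s₁ • Pi.single (a 0) (1 : ZMod 2) + s₂ • Pi.single (a 1) (1 : ZMod 2) + s₃ • Pi.single (a 2) (1 : ZMod 2) +
              s₄ • Pi.single (a 3) (1 : ZMod 2) : Fin n → ZMod 2) v₁) ≠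
            ((y + s₁ • Pi.single (a 0) (1 : ZMod 2) + s₂ • Pi.single (a 1) (1 : ZMod 2) + s₃ • Pi.single (a 2) (1 : ZMod 2) +
              s₄ • Pi.single (a 3) (1 : ZMod 2) : Fin n → ZMod 2) v₂) := by
          rw [cube_v₁, cube_v₂]; exact hyv
        refine hb _ hzu ?_
        rw [hqd _ hzu hzv, hs, add_zero])
    rw [hqd y hyu hyv, hres.1]; decide
  -- hence `polarDir mv` vanishes on pairs of the four directions
  have y₁ : ∃ y : Fin n → ZMod 2, y u = κ₀ + 1 ∧ y v₁ ≠ y v₂ ∧ ∀ i, y + Pi.single (a i) 1 ≠ 0 := by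
    refine ⟨Pi.single v₁ 1, by rw [Pi.single_eq_of_ne (Ne.symm hv₁u), hκ]; decide,
      by rw [Pi.single_eq_same, Pi.single_eq_of_ne (Ne.symm hv12)]; exact one_ne_zero, fun i h => ?_⟩
    have := congrFun h v₁
    rw [Pi.add_apply, Pi.single_eq_same, Pi.single_eq_of_ne (Ne.symm (hav i).1), add_zero, Pi.zero_apply] at this
    exact one_ne_zero this
  have hB0 : ∀ i j, polarDir I B mv (Pi.single (a i) 1) (Pi.single (a j) 1) = 0 := by
    intro i j
    obtain ⟨y, hyu, hyv, -⟩ := y₁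
    have h := qDir_add I B mv (y + Pi.single (a i) 1) (Pi.single (a j) 1)
    have h' := qDir_add I B mv y (Pi.single (a j) 1)
    rw [map_add, LinearMap.add_apply] at h
    have hq1 := hH1K (y + Pi.single (a i) 1 + Pi.single (a j) 1) (by rw [hcu, hcu, hyu]) (by rw [hcv₁, hcv₁, hcv₂, hcv₂]; exact hyv)
    have hq2 := hH1K (y + Pi.single (a i) 1) (by rw [hcu, hyu]) (by rw [hcv₁, hcv₂]; exact hyv)
    have hq3 := hH1K (y + Pi.single (a j) 1) (by rw [hcu, hyu]) (by rw [hcv₁, hcv₂]; exact hyv)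
    have hq4 := hH1K y hyu hyv
    rw [← hqdef] at h h'
    rw [hq1, hq2] at h
    rw [hq3, hq4] at h'
    have e : ∀ qj q0 P s : ZMod 2, (0 : ZMod 2) = 0 + qj + q0 + (P + s) → (0 : ZMod 2) = 0 + qj + q0 + P → s = 0 := by decide
    exact e _ _ _ _ h h'
  -- STEP 2: on `H₀ ∩ K`, `q ≡ 1` (the cube argument for `q` itself, whose polar form vanishes on the four directions)
  have hH0K : ∀ x : Fin n → ZMod 2, x u = κ₀ → x v₁ = x v₂ → q x = 1 := by
    intro x hxu hxv
    set Lq : Fin 4 → (Fin n → ZMod 2) → ZMod 2 := fun i z => q (Pi.single (a i) 1) + q 0 + polarDir I B mv z (Pi.single (a i) 1) with hLq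
    have hQ : ∀ i z, q (z + Pi.single (a i) 1) = q z + Lq i z := by
      intro i z; simp only [hLq, hqdef]; rw [qDir_add]; ring
    have hLinv : ∀ i j z, Lq i (z + Pi.single (a j) 1) = Lq i z := by
      intro i j z; simp only [hLq]; rw [map_add, LinearMap.add_apply, PstarChordBridgeNor.polarDir_comm I B mv (Pi.single (a j) 1), hB0 i j, add_zero]
    -- `u_e = x_{v₁} + λ`-type constancy: on the cube, `(c)` gives `u_e = v₁`-coordinate, constant
    have hres := cube16 (Q := q) (A := (sys I B).u e) (L := Lq) (a := a) hQ hLinv hA0 hA1 hA2 hA3 h02 h03 h12 h13 x (x v₁)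
      (fun s₁ s₂ s₃ s₄ hs => by
        have hzu := cube_u x s₁ s₂ s₃ s₄
        rw [hxu] at hzu
        have h := (hc _ hzu hs).2
        rw [cube_v₁] at h
        exact h)
    exact hres.1
  -- STEP 3: `d` is `1 + ε` on `H₁ ∩ K`, `ε = polarDir mv (e_{v₁}, e_u)`
  set ε := polarDir I B mv (Pi.single v₁ 1) eu with hε
  have hdK : ∀ y : Fin n → ZMod 2, y u = κ₀ + 1 → y v₁ = y v₂ → d y = 1 + ε := by
    intro y hyu hyv
    -- `y + e_{v₁} ∈ H₁ ∖ K`, where `d = q + q(· + e_u) = 0 + 1`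
    set y' := y + Pi.single v₁ 1 with hy'
    have hy'u : y' u = κ₀ + 1 := by rw [hy', Pi.add_apply, Pi.single_eq_of_ne (Ne.symm hv₁u), add_zero, hyu]
    have hy'v : y' v₁ ≠ y' v₂ := by
      rw [hy', Pi.add_apply, Pi.add_apply, Pi.single_eq_same, Pi.single_eq_of_ne (Ne.symm hv12), add_zero, hyv]
      generalize y v₂ = t; revert t; decide
    have hd' : d y' = 1 := by
      simp only [hddef]
      have h0 := hH1K y' hy'u hy'v
      have h1 := hq0K (y' + eu) (by rw [Pi.add_apply, hy'u, heu, Pi.single_eq_same, hκ]; decide)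
        (by rwa [Pi.add_apply, Pi.add_apply, heu, Pi.single_eq_of_ne hv₁u, Pi.single_eq_of_ne hv₂u, add_zero, add_zero])
      rw [h0, h1, zero_add]
    have hyy : y = y' + Pi.single v₁ 1 := by
      ext i; rw [hy', Pi.add_apply, Pi.add_apply]
      generalize y i = s; generalize (Pi.single v₁ (1 : ZMod 2) : Fin n → ZMod 2) i = t; revert s t; decide
    rw [hyy, hd_flip, hd']
  -- `q` on `H₁ ∩ K` is `ε`
  have hqK1 : ∀ y : Fin n → ZMod 2, y u = κ₀ + 1 → y v₁ = y v₂ → q y = ε := by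
    intro y hyu hyv
    have h := hdK y hyu hyv
    simp only [hddef] at h
    have h1 := hH0K (y + eu) (by rw [Pi.add_apply, hyu, heu, Pi.single_eq_same, hκ]; decide)
      (by rw [Pi.add_apply, Pi.add_apply, heu, Pi.single_eq_of_ne hv₁u, Pi.single_eq_of_ne hv₂u, add_zero, add_zero, hyv])
    rw [h1] at h
    have e2 : ∀ a k : ZMod 2, a + 1 = 1 + k → a = k := by decide
    exact e2 _ _ h
  rcases z01 ε with hε0 | hε1
  · -- `ε = 0`: `q = x_u + κ₀ + 1` is affine
    refine hq fun x w => ?_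
    have hqx : ∀ x : Fin n → ZMod 2, q x = x u + κ₀ + 1 := by
      intro x
      have hcu' : ∀ t k : ZMod 2, t = k ∨ t = k + 1 := by decide
      rcases hcu' (x u) κ₀ with h | h
      · have h1 : q x = 1 := by
          by_cases hxv : x v₁ = x v₂
          · exact hH0K x h hxv
          · exact hq0K x h hxv
        rw [h1, h]; generalize κ₀ = k; revert k; decide
      · have h0 : q x = 0 := by
          by_cases hxv : x v₁ = x v₂
          · rw [hqK1 x h hxv, hε0]
          · exact hH1K x h hxv
        rw [h0, h]; generalize κ₀ = k; revert k; decide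
    simp only [hqx, Pi.add_apply, Pi.zero_apply]
    have e3 : ∀ s t k : ZMod 2, s + t + k + 1 = s + k + 1 + (t + k + 1) + (0 + k + 1) := by decide
    exact e3 _ _ _
  · -- `ε = 1`: `q ≡ 1` on `H₁ ∩ K`, so `u_e ≡ 0` there — contradicted by the flip `e_α + e_{α'}`
    have h0u : (0 : Fin n → ZMod 2) u = κ₀ + 1 := by rw [Pi.zero_apply, hκ]; decide
    have hA00 := hb 0 h0u (by rw [hqK1 0 h0u rfl, hε1])
    set yy : Fin n → ZMod 2 := (0 : Fin n → ZMod 2) + Pi.single (a 0) 1 + Pi.single (a 1) 1 with hyy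
    have hyyu : yy u = κ₀ + 1 := by rw [hyy, hcu, hcu, h0u]
    have hyyv : yy v₁ = yy v₂ := by rw [hyy, hcv₁, hcv₁, hcv₂, hcv₂, Pi.zero_apply, Pi.zero_apply]
    have hA11 := hb yy hyyu (by rw [hqK1 yy hyyu hyyv, hε1])
    rw [hyy, hA1, hA0, hA00, Pi.add_apply, Pi.zero_apply, Pi.zero_apply, Pi.single_eq_same] at hA11
    exact absurd hA11 (by decide)

end Summit.PneNP.PneNP.Theorems.PstarGateCaseTQuadThree
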